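import Summits.AtomisticToContinuum.HydrodynamicLimit.Theorems.CollisionIsometryCLTCollisionalTransferLocalityDefs
import Summits.AtomisticToContinuum.HydrodynamicLimit.Theorems.AprioriBounds.Negative.ExpMomentTangent
import Summits.AtomisticToContinuum.HydrodynamicLimit.Theorems.AprioriBounds.Negative.BlockDensityAveraging
import Summits.AtomisticToContinuum.HydrodynamicLimit.Theorems.AprioriBounds.Negative.AdmissibleKernel
import Literature.Analysis.FluidPDE.HardSphereAlexander
import Literature.Analysis.FluidPDE.HardSphereFlowRegular
import Literature.Analysis.FluidPDE.HardSpherePhaseSpaceProofs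
import Literature.Analysis.FluidPDE.HardSphereTrajectoryMeasurable
import HarnessLib

/-!
# The `∀ t` a-priori supply of the line `hemisphere-affine-slaving` is false modulo a persistent vacuum

Negative lemma (registered as `aprioriAllTimes_false_of_persistentVacuum`, settling the stub
`stub_aprioriAllTimes` of the skeleton of crux stmt-AtomisticToContinuum-9518
`CollisionalTransferLocality` NEGATIVELY, modulo a hypothesis).

The stub `stub_aprioriAllTimes` asks, for all nice profiles, small `σ`, EVERY flow family `Φ` and
EVERY horizon `t > 0`, for the time-averaged exponential velocity moment `ExpMomAt σ a₀ θ₀ u₀ Φ t` and,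
for every admissible kernel family, the density window `WindowAt σ a₀ θ₀ u₀ Φ t φ`: a floor `c₁ > 0`
under ALL mesoscopic block densities `ρ̄(s, x) = (N+1)⁻¹∑ᵢ φ_N(xᵢ(s) - x)` (and the ceiling
`ρ̄σ³ ≤ 1`) at ALL times `s ≤ t`, with local-Gibbs probability `→ 1` — verbatim the conclusion of the
retired a-priori crux stmt-9519.  The hypothesis is a space–time law of large numbers for the tested
density on some window `[t₁, t₂]` toward a window-integrated limit density `ρI` with VACUUM in the tested
sense (for every level `c > 0` some continuous `0 ≤ χ ≤ 1` with `∫χ > 0` has `∫χρI < c∫χ`), as gas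
dynamics predicts behind the reflected shock of a Guderley implosion or in a cavitating flow.  A block
floor `c₁` forces the tested mass `(N+1)⁻¹∑ᵢ χ(xᵢ(s)) ≥ c₁∫χ − o(1)` for every continuous `0 ≤ χ ≤ 1`
(deterministic, `le_empiricalDensityField_of_blockFloor`: the kernels are approximate identities),
hence `∫_{t₁}^{t₂}(N+1)⁻¹∑ᵢχ(xᵢ(s))ds ≥ (t₂ − t₁)(c₁∫χ − o(1))`
(`mul_le_setIntegral_empiricalDensityField`), contradicting the law of large numbers at the vacuum
test function of level `c = c₁(t₂ − t₁)/2`.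

The three helper lemmas and the proof are adapted from
`Theorems/AprioriBounds/Negative/AprioriBoundsFalseOfPersistentVacuum.lean` (refuter cdisprove 9519,
cycle 3), restated in the line's vocabulary (`NiceProfiles`, `Flows`, `ExpMomAt`, `WindowAt`,
`AdmissibleKernel` of `…CollisionalTransferLocalityDefs`); that module is not imported (its deciding
theorem names the retired route declaration).  The admissible kernel family used is the tree's torus
mollifier (`AprioriBoundsNegative.exists_admissibleKernelFamily`), the flow family is Alexander's
regularised hard-sphere flow (`Alexander.regHardSphereFlow`).
-/

namespace Summit.AtomisticToContinuum.HydrodynamicLimit.Theorems.HemisphereAffineSlaving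

open scoped BigOperators Topology ENNReal
open Filter Set Function MeasureTheory

noncomputable section

open Literature.MathematicalPhysics.KineticTheory (T3 V3)
open Literature.MathematicalPhysics.KineticTheory Literature.Analysis.FluidPDE

/-! ### Deterministic core: a block floor bounds the tested mass from below -/

-- adapted from Theorems/AprioriBounds/Negative/AprioriBoundsFalseOfPersistentVacuum.lean (refuter cdisprove 9519 cycle 3)
/-- Mathlib's distance on `𝕋³` is dominated by the minimal-image distance in the crux's orientation:
`dist x y ≤ euclidDist (y - x) 0` (`= euclidDist y x`, the crux measures kernel supports from `0`). -/
private theorem pv_dist_le_euclidDist_sub_zero (x y : T3) : dist x y ≤ Torus.euclidDist (y - x) 0 := by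
  have h : Torus.euclidDist (y - x) 0 = Torus.euclidDist y x := by
    rw [Torus.euclidDist_eq, Torus.euclidDist_eq, sub_zero]
  rw [h, dist_eq_norm, ← norm_sub_rev]
  exact Torus.norm_sub_le_euclidDist_holds y x

-- adapted from Theorems/AprioriBounds/Negative/AprioriBoundsFalseOfPersistentVacuum.lean (refuter cdisprove 9519 cycle 3)
/-- **Block floor ⇒ tested-mass floor (deterministic, every configuration).**  Let `φ ≥ 0` be a
kernel of mass one vanishing outside the ball `{euclidDist · 0 < r}`, and `χ ≥ 0` a test function
with `r`-modulus `ε` (`χ x ≤ χ y + ε` whenever `euclidDist (y - x) 0 < r`).  If EVERY block of the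
configuration `w` has density at least `c₁` (`c₁ ≤ (N+1)⁻¹∑ᵢ φ(xᵢ - x)` for all `x`), then the tested
mass is at least `c₁ ∫χ - ε`:  `c₁ ∫ χ ≤ (N+1)⁻¹ ∑ᵢ χ(xᵢ) + ε`.  (Integrate the floor against `χ`
and use that `φ(xᵢ - ·)` is a probability density concentrated where `χ ≤ χ(xᵢ) + ε`.) -/
private theorem pv_le_empiricalDensityField_of_blockFloor {N : ℕ} (w : Config (N + 1) (Fin 3) T3)
    {φ : T3 → ℝ} (hφ0 : ∀ y, 0 ≤ φ y) (hφi : Integrable φ) (hφ1 : ∫ y, φ y = 1) {r : ℝ}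
    (hsupp : ∀ y, r ≤ Torus.euclidDist y 0 → φ y = 0)
    {χ : T3 → ℝ} (hχc : Continuous χ) (hχ0 : ∀ x, 0 ≤ χ x) (hχ1 : ∀ x, χ x ≤ 1) {ε : ℝ}
    (hmod : ∀ x y : T3, Torus.euclidDist (y - x) 0 < r → χ x ≤ χ y + ε)
    {c₁ : ℝ} (hfloor : ∀ x, c₁ ≤ empiricalDensityField w (fun y => φ (y - x))) :
    c₁ * ∫ x, χ x ≤ empiricalDensityField w χ + ε := by
  haveI : (volume : Measure T3).IsNegInvariant :=
    Measure.IsAddHaarMeasure.isNegInvariant_of_regular _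
  have hχi : Integrable χ := by
    refine Integrable.of_bound (μ := volume) hχc.aestronglyMeasurable 1
      (Eventually.of_forall fun x => ?_)
    rw [Real.norm_eq_abs, abs_of_nonneg (hχ0 x)]
    exact hχ1 x
  -- the block density as a finite sum
  set c : ℝ := ((N + 1 : ℕ) : ℝ)⁻¹ with hc
  have hc0 : 0 ≤ c := by positivity
  have hρ : ∀ x, empiricalDensityField w (fun y => φ (y - x)) = c * ∑ i, φ ((w i).1 - x) :=
    fun x => AprioriBoundsNegative.blockDensity_eq w φ x
  -- each translated kernel, integrated against `χ`, is at most `χ(xᵢ) + ε`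
  have hterm_int : ∀ i : Fin (N + 1), Integrable fun x => χ x * φ ((w i).1 - x) := fun i =>
    (hφi.comp_sub_left (w i).1).bdd_mul hχc.aestronglyMeasurable
      (Eventually.of_forall fun x => by
        rw [Real.norm_eq_abs, abs_of_nonneg (hχ0 x)]; exact hχ1 x)
  have hterm : ∀ i : Fin (N + 1), ∫ x, χ x * φ ((w i).1 - x) ≤ χ (w i).1 + ε := by
    intro i
    have hpt : ∀ x, χ x * φ ((w i).1 - x) ≤ (χ (w i).1 + ε) * φ ((w i).1 - x) := by
      intro x
      by_cases h0 : φ ((w i).1 - x) = 0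
      · simp [h0]
      · have hlt : Torus.euclidDist ((w i).1 - x) 0 < r := by
          by_contra hge
          exact h0 (hsupp _ (not_lt.1 hge))
        exact mul_le_mul_of_nonneg_right (hmod x (w i).1 hlt) (hφ0 _)
    calc ∫ x, χ x * φ ((w i).1 - x) ≤ ∫ x, (χ (w i).1 + ε) * φ ((w i).1 - x) :=
          integral_mono (hterm_int i) ((hφi.comp_sub_left (w i).1).const_mul _) hpt
      _ = (χ (w i).1 + ε) * ∫ x, φ ((w i).1 - x) := integral_const_mul _ _
      _ = (χ (w i).1 + ε) * 1 := by rw [integral_sub_left_eq_self φ volume, hφ1]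
      _ = χ (w i).1 + ε := mul_one _
  -- integrate the floor against `χ`
  have hprod_eq : (fun x => χ x * empiricalDensityField w (fun y => φ (y - x))) =
      fun x => c * ∑ i, χ x * φ ((w i).1 - x) := by
    funext x; rw [hρ x, Finset.mul_sum, Finset.mul_sum, Finset.mul_sum]
    refine Finset.sum_congr rfl fun i _ => ?_; ring
  have hprod_int : Integrable fun x => χ x * empiricalDensityField w (fun y => φ (y - x)) := by
    rw [hprod_eq]; exact (integrable_finsetSum _ fun i _ => hterm_int i).const_mul _
  have hlow : c₁ * ∫ x, χ x ≤ ∫ x, χ x * empiricalDensityField w (fun y => φ (y - x)) := by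
    rw [← integral_const_mul]
    refine integral_mono (hχi.const_mul _) hprod_int fun x => ?_
    have := mul_le_mul_of_nonneg_left (hfloor x) (hχ0 x)
    linarith [mul_comm c₁ (χ x)]
  have hup : ∫ x, χ x * empiricalDensityField w (fun y => φ (y - x)) ≤
      empiricalDensityField w χ + ε := by
    rw [hprod_eq, integral_const_mul, integral_finsetSum _ (fun i _ => hterm_int i),
      AprioriBoundsNegative.empiricalDensityField_eq_sum]
    have hsum : ∑ i, ∫ x, χ x * φ ((w i).1 - x) ≤ ∑ i, (χ (w i).1 + ε) :=
      Finset.sum_le_sum fun i _ => hterm i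
    have h1 : c * ∑ i : Fin (N + 1), (χ (w i).1 + ε) = c * ∑ i, χ (w i).1 + ε := by
      rw [Finset.sum_add_distrib, Finset.sum_const, Finset.card_univ, Fintype.card_fin,
        nsmul_eq_mul, mul_add, ← mul_assoc c, hc, inv_mul_cancel₀ (by positivity), one_mul]
    calc c * ∑ i, ∫ x, χ x * φ ((w i).1 - x) ≤ c * ∑ i, (χ (w i).1 + ε) :=
          mul_le_mul_of_nonneg_left hsum hc0
      _ = c * ∑ i, χ (w i).1 + ε := h1
  exact hlow.trans hup

/-! ### Time integration along a good orbit -/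

-- adapted from Theorems/AprioriBounds/Negative/AprioriBoundsFalseOfPersistentVacuum.lean (refuter cdisprove 9519 cycle 3)
/-- Along the orbit of a good point, a pointwise floor `L ≤ (N+1)⁻¹∑ᵢ χ(xᵢ(s))` on `[t₁, t₂]`
integrates to `L (t₂ - t₁) ≤ ∫_{[t₁,t₂]} (N+1)⁻¹∑ᵢ χ(xᵢ(s)) ds` (the tested mass is measurable in
time along hard-sphere trajectories and takes values in `[0, 1]` for `0 ≤ χ ≤ 1`). -/
private theorem pv_mul_le_setIntegral_empiricalDensityField {N : ℕ} {ε' : ℝ}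
    (Φ : HardSphereFlow (Torus.geometry (Fin 3)) ε' (N + 1)) {z : Config (N + 1) (Fin 3) T3}
    (hz : z ∈ Φ.good) {χ : T3 → ℝ} (hχc : Continuous χ) (hχ0 : ∀ x, 0 ≤ χ x) (hχ1 : ∀ x, χ x ≤ 1)
    {t₁ t₂ L : ℝ} (ht : t₁ ≤ t₂)
    (hL : ∀ s ∈ Icc t₁ t₂, L ≤ empiricalDensityField (Φ.flow s z) χ) :
    L * (t₂ - t₁) ≤ ∫ s in Icc t₁ t₂, empiricalDensityField (Φ.flow s z) χ := by
  set γ : ℝ → Config (N + 1) (Fin 3) T3 := fun s => Φ.flow s z with hγ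
  have htraj : IsHardSphereTrajectory (Torus.geometry (Fin 3)) ε' (N + 1) γ := Φ.isTrajectory z hz
  have hγm : Measurable γ := htraj.measurable_torus
  have hχm : Measurable χ := hχc.measurable
  set c : ℝ := ((N + 1 : ℕ) : ℝ)⁻¹ with hc
  have hmwm : Measurable fun w : Config (N + 1) (Fin 3) T3 => empiricalDensityField w χ := by
    have : (fun w : Config (N + 1) (Fin 3) T3 => empiricalDensityField w χ) =
        fun w => c * ∑ i, χ (w i).1 :=
      funext fun w => AprioriBoundsNegative.empiricalDensityField_eq_sum w χ
    rw [this]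
    exact measurable_const.mul (Finset.measurable_sum _ fun i _ =>
      hχm.comp (measurable_pi_apply i).fst)
  set m : ℝ → ℝ := fun s => empiricalDensityField (Φ.flow s z) χ with hm
  have hmm : Measurable m := hmwm.comp hγm
  have hmb : ∀ s, 0 ≤ m s ∧ m s ≤ 1 := fun s =>
    AprioriBoundsNegative.empiricalDensityField_mem_Icc hχ0 hχ1 _
  haveI : IsFiniteMeasure (volume.restrict (Icc t₁ t₂)) := by infer_instance
  have hmi : Integrable m (volume.restrict (Icc t₁ t₂)) :=
    Integrable.of_bound hmm.aestronglyMeasurable 1 (Eventually.of_forall fun s => by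
      rw [Real.norm_eq_abs, abs_of_nonneg (hmb s).1]; exact (hmb s).2)
  have hae : ∀ᵐ s ∂(volume.restrict (Icc t₁ t₂)), (fun _ => L) s ≤ m s :=
    ae_restrict_of_forall_mem measurableSet_Icc fun s hs => hL s hs
  have hmono : ∫ s in Icc t₁ t₂, (fun _ => L) s ≤ ∫ s in Icc t₁ t₂, m s :=
    integral_mono_ae (integrable_const L) hmi hae
  have hconst : ∫ s in Icc t₁ t₂, (fun _ : ℝ => L) s = L * (t₂ - t₁) := by
    simp only
    rw [setIntegral_const, smul_eq_mul, Measure.real, Real.volume_Icc,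
      ENNReal.toReal_ofReal (by linarith), mul_comm]
  rw [← hconst]
  exact hmono

/-! ### The negative lemma -/

/-- **Registered negative lemma `aprioriAllTimes_false_of_persistentVacuum`** (settles
`stub_aprioriAllTimes` of crux stmt-AtomisticToContinuum-9518, line hemisphere-affine-slaving, as
FALSE modulo a hypothesis).  HYPOTHESIS (persistent vacuum; deliberately not a literature fact —
nobody has derived it for hard spheres): for SOME nice profiles there is `σ₁ > 0` such that for all
`0 < σ < σ₁` and every flow family there are a window `0 ≤ t₁ < t₂` and a window-integrated limit
density `ρI` with (1) a space–time law of large numbers for the tested density under the local Gibbs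
laws, `|∫_{t₁}^{t₂}(N+1)⁻¹∑ᵢχ(xᵢ(s))ds − ∫χρI| ≤ δ` w.h.p. for every continuous `χ` and `δ > 0`, and
(2) vacuum: for every `c > 0` some continuous `0 ≤ χ ≤ 1` with `∫χ > 0` has `∫χρI < c∫χ`.
CONCLUSION: the `∀ t` a-priori supply (`ExpMomAt ∧ (AdmissibleKernel → WindowAt)` for all nice
profiles, small `σ`, all flow families and ALL `t > 0`) fails — its density floor `c₁ ≤ ρ̄` on all
blocks and all `s ≤ t₂` forces `∫_{t₁}^{t₂}(N+1)⁻¹∑ᵢχ(xᵢ(s))ds ≥ (t₂ − t₁)(c₁∫χ − c₁∫χ/8)` on the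
good set once the kernel radius is below the `c₁∫χ/8`-modulus of `χ`, contradicting (1) at the `χ` of
(2) with `c = c₁(t₂ − t₁)/2` and `δ = c₁(t₂ − t₁)∫χ/4`.  Kernel family: the torus mollifier
(`AprioriBoundsNegative.exists_admissibleKernelFamily`); flows: `Alexander.regHardSphereFlow`.
[folklore] -/
theorem aprioriAllTimes_false_of_persistentVacuum : (∃ (a₀ θ₀ : T3 → ℝ) (u₀ : T3 → V3), NiceProfiles a₀ θ₀ u₀ ∧ ∃ σ₁ : ℝ, 0 < σ₁ ∧ ∀ σ : ℝ, 0 < σ → σ < σ₁ → ∀ Φ : Flows σ, ∃ t₁ t₂ : ℝ, 0 ≤ t₁ ∧ t₁ < t₂ ∧ ∃ ρI : T3 → ℝ, (∀ χ : T3 → ℝ, Continuous χ → ∀ δ : ℝ, 0 < δ → Tendsto (fun N : ℕ => Literature.MathematicalPhysics.KineticTheory.localGibbsLaw σ a₀ u₀ θ₀ N (Φ N) {z | δ < |(∫ s in Icc t₁ t₂, Literature.MathematicalPhysics.KineticTheory.empiricalDensityField ((Φ N).flow s z) χ) - ∫ x, χ x * ρI x|}) atTop (𝓝 0)) ∧ (∀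 c : ℝ, 0 < c → ∃ χ : T3 → ℝ, Continuous χ ∧ (∀ x, 0 ≤ χ x) ∧ (∀ x, χ x ≤ 1) ∧ 0 < ∫ x, χ x ∧ (∫ x, χ x * ρI x) < c * ∫ x, χ x)) → ¬ (∀ (a₀ θ₀ : T3 → ℝ) (u₀ : T3 → V3), NiceProfiles a₀ θ₀ u₀ → ∃ σ₀ : ℝ, 0 < σ₀ ∧ ∀ σ : ℝ, 0 < σ → σ < σ₀ → ∀ (Φ : Flows σ) (t : ℝ), 0 < t → ExpMomAt σ a₀ θ₀ u₀ Φ t ∧ ∀ (γ C : ℝ) (φ : ℕ → T3 → ℝ), 0 < γ → γ ≤ 1 / 15 → AdmissibleKernel γ C φ → WindowAt σ a₀ θ₀ u₀ Φ t φ) := by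
  rintro ⟨a₀, θ₀, u₀, hP, σ₁, hσ₁, hH⟩ hAB
  obtain ⟨σ₀, hσ₀, hA⟩ := hAB a₀ θ₀ u₀ hP
  obtain ⟨ha, hθ, hu, ha0, hθ0⟩ := hP
  -- a common small reduced density
  have hmin : 0 < min (min σ₀ σ₁) (1 / 2) := lt_min (lt_min hσ₀ hσ₁) (by norm_num)
  set σ : ℝ := min (min σ₀ σ₁) (1 / 2) / 2 with hσdef
  have hσ : 0 < σ := half_pos hmin
  have hσlt : σ < min (min σ₀ σ₁) (1 / 2) := half_lt_self hmin
  have hσσ₀ : σ < σ₀ := hσlt.trans_le ((min_le_left _ _).trans (min_le_left _ _))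
  have hσσ₁ : σ < σ₁ := hσlt.trans_le ((min_le_left _ _).trans (min_le_right _ _))
  have hσ2 : σ < 1 / 2 := hσlt.trans_le (min_le_right _ _)
  -- a flow family (Alexander's theorem)
  set Φ : Flows σ :=
    fun N => Alexander.regHardSphereFlow (d := Fin 3) (hsDiameter_pos hσ N)
      ((hsDiameter_le hσ.le N).trans_lt (by linarith)) (N + 1) with hΦ
  obtain ⟨t₁, t₂, ht₁, ht₁₂, ρI, hconv, hvac⟩ := hH σ hσ hσσ₁ Φ
  have ht₂ : 0 < t₂ := ht₁.trans_lt ht₁₂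
  have hΔ : 0 < t₂ - t₁ := sub_pos.2 ht₁₂
  -- the admissible kernel family and the floor `c₁` claimed by the window at `t = t₂`
  obtain ⟨γ, C, φ, hγ, hγ', hsm, hnn, hmass, hsupp, hsup, hgrad, hint⟩ :=
    AprioriBoundsNegative.exists_admissibleKernelFamily
  have hW : WindowAt σ a₀ θ₀ u₀ Φ t₂ φ :=
    (hA σ hσ hσσ₀ Φ t₂ ht₂).2 γ C φ hγ hγ' ⟨hsm, hnn, hmass, hsupp, hsup, hgrad⟩
  obtain ⟨c₁, hc₁, hT⟩ := hW
  -- the vacuum test function at level `c = c₁ (t₂ - t₁) / 2`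
  obtain ⟨χ, hχc, hχ0, hχ1, hI, hM⟩ := hvac (c₁ * (t₂ - t₁) / 2) (by positivity)
  set I : ℝ := ∫ x, χ x with hIdef
  set M : ℝ := ∫ x, χ x * ρI x with hMdef
  -- LLN tolerance and modulus of continuity
  set δ : ℝ := c₁ * (t₂ - t₁) * I / 4 with hδdef
  have hδ0 : 0 < δ := by positivity
  have hB := hconv χ hχc δ hδ0
  set ε : ℝ := c₁ * I / 8 with hεdef
  have hε0 : 0 < ε := by positivity
  obtain ⟨η, hη0, hηmod⟩ := Metric.uniformContinuous_iff.1
    (CompactSpace.uniformContinuous_of_continuous hχc) ε hε0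
  -- the kernel radius is eventually below `η`
  have hrad : Tendsto (fun N : ℕ => ((N : ℝ) + 1) ^ (-γ)) atTop (𝓝 0) :=
    (tendsto_rpow_neg_atTop hγ).comp
      (tendsto_atTop_add_const_right _ 1 tendsto_natCast_atTop_atTop)
  obtain ⟨N₁, hN₁⟩ := eventually_atTop.1 (hrad.eventually (gt_mem_nhds hη0))
  -- the events
  set P : (N : ℕ) → Measure (Config (N + 1) (Fin 3) T3) :=
    fun N => localGibbsLaw σ a₀ u₀ θ₀ N (Φ N) with hPdef
  set Bad : (N : ℕ) → Set (Config (N + 1) (Fin 3) T3) := fun N =>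
    {z | ∃ s ∈ Icc 0 t₂, ∃ x : T3,
      empiricalDensityField ((Φ N).flow s z) (fun y => φ N (y - x)) < c₁ ∨
        1 < empiricalDensityField ((Φ N).flow s z) (fun y => φ N (y - x)) * σ ^ 3} with hBaddef
  set B1 : (N : ℕ) → Set (Config (N + 1) (Fin 3) T3) := fun N =>
    {z | δ < |(∫ s in Icc t₁ t₂, empiricalDensityField ((Φ N).flow s z) χ) - M|} with hB1def
  -- deterministic covering for `N ≥ N₁`
  have hcover : ∀ N, N₁ ≤ N → (univ : Set (Config (N + 1) (Fin 3) T3)) ⊆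
      Bad N ∪ B1 N ∪ ((Φ N).good)ᶜ := by
    intro N hN z _
    by_cases hz : z ∈ (Φ N).good
    · by_cases h1 : δ < |(∫ s in Icc t₁ t₂, empiricalDensityField ((Φ N).flow s z) χ) - M|
      · exact Or.inl (Or.inr h1)
      by_cases hbad : z ∈ Bad N
      · exact Or.inl (Or.inl hbad)
      -- no bad block on `[0, t₂]`, LLN `δ`-good: derive a contradiction
      exfalso
      have hfloor : ∀ s ∈ Icc t₁ t₂, ∀ x,
          c₁ ≤ empiricalDensityField ((Φ N).flow s z) (fun y => φ N (y - x)) := by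
        intro s hs x
        by_contra hlt
        exact hbad ⟨s, ⟨ht₁.trans hs.1, hs.2⟩, x, Or.inl (not_le.1 hlt)⟩
      have hmod : ∀ x y : T3, Torus.euclidDist (y - x) 0 < ((N : ℝ) + 1) ^ (-γ) →
          χ x ≤ χ y + ε := by
        intro x y hxy
        have hd : dist x y < η :=
          (pv_dist_le_euclidDist_sub_zero x y).trans_lt (hxy.trans (hN₁ N hN))
        have := hηmod hd
        rw [Real.dist_eq] at this
        linarith [(abs_lt.1 this).1, (abs_lt.1 this).2]
      have hpt : ∀ s ∈ Icc t₁ t₂,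
          c₁ * I - ε ≤ empiricalDensityField ((Φ N).flow s z) χ := by
        intro s hs
        have := pv_le_empiricalDensityField_of_blockFloor ((Φ N).flow s z) (hnn N) (hint N)
          (hmass N) (hsupp N) hχc hχ0 hχ1 hmod (hfloor s hs)
        linarith
      have hlowint : (c₁ * I - ε) * (t₂ - t₁) ≤
          ∫ s in Icc t₁ t₂, empiricalDensityField ((Φ N).flow s z) χ :=
        pv_mul_le_setIntegral_empiricalDensityField (Φ N) hz hχc hχ0 hχ1 ht₁₂.le hpt
      have hupint : (∫ s in Icc t₁ t₂, empiricalDensityField ((Φ N).flow s z) χ) ≤ M + δ := by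
        have := (abs_le.1 (not_lt.1 h1)).2
        linarith
      -- arithmetic: `(c₁ I - c₁ I/8)(t₂ - t₁) ≤ M + c₁ (t₂ - t₁) I/4 < (3/4) c₁ (t₂ - t₁) I`
      have hM' : M < c₁ * (t₂ - t₁) / 2 * I := hM
      have hpos : 0 < c₁ * I * (t₂ - t₁) := by positivity
      rw [hεdef] at hlowint
      rw [hδdef] at hupint
      nlinarith
    · exact Or.inr hz
  have hbound : ∀ N, N₁ ≤ N → (1 : ℝ≥0∞) ≤ P N (Bad N) + P N (B1 N) := by
    intro N hN
    haveI := isProbabilityMeasure_localGibbsLaw ha hθ hu ha0 hθ0 hσ2.le N (Φ N)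
    have hg : P N ((Φ N).good)ᶜ = 0 := by
      rw [hPdef]
      show localGibbsLaw σ a₀ u₀ θ₀ N (Φ N) ((Φ N).good)ᶜ = 0
      rw [localGibbsLaw_eq]
      exact localGibbsMeasure_absolutelyContinuous σ a₀ u₀ θ₀ N (Φ N) (Φ N).measure_compl_good
    calc (1 : ℝ≥0∞) = P N univ := measure_univ.symm
      _ ≤ P N (Bad N ∪ B1 N ∪ ((Φ N).good)ᶜ) := measure_mono (hcover N hN)
      _ ≤ P N (Bad N ∪ B1 N) + P N ((Φ N).good)ᶜ := measure_union_le _ _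
      _ ≤ P N (Bad N) + P N (B1 N) + P N ((Φ N).good)ᶜ :=
          add_le_add (measure_union_le _ _) le_rfl
      _ = P N (Bad N) + P N (B1 N) := by rw [hg, add_zero]
  have hlim : Tendsto (fun N => P N (Bad N) + P N (B1 N)) atTop (𝓝 0) := by
    have h := hT.add hB
    rw [add_zero] at h
    exact h
  have h10 : (1 : ℝ≥0∞) ≤ 0 :=
    ge_of_tendsto hlim (eventually_atTop.2 ⟨N₁, fun N hN => hbound N hN⟩)
  exact absurd h10 (by norm_num)

end

end Summit.AtomisticToContinuum.HydrodynamicLimit.Theorems.HemisphereAffineSlaving
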